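import Summits.QuantumFields.YangMills.Theorems.BalabanUVNodesK0Stub2PrimeHolds
import Summits.QuantumFields.YangMills.Theorems.BalabanUVNodesK0Stub2PrimeDatumForm
import Summits.QuantumFields.YangMills.Theorems.BalabanUVNodesK0Stub2PrimeFluxFloor

/-!
# K0⁷ STUB 2′ (V19 `stub_prop6MemberB8AtP13`, CLOSED by k0-s2-w1's `K0Stub2PrimeHolds.prop6MemberB8AtP_holds`) — THE PROVED SENTENCE IN PRINT'S WORDS:
# [6] PROPOSITION 6 AT EVERY BARE PRINT-FAITHFUL CUBE DATUM OF `ℤ⁴ × U(2)`, index-free, with a POSITIVE constant `B₁ ≥ (2912·L⁵)⁻¹`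

Cell `pub-ymgap`, seat `pub-ymgap-k0-s2-w2` g2 (K0⁷ stub-2 width seat 2∕2, director-ym №197 ∕ HUMAN RULING D-0149).  Key K0⁷
**stmt-QuantumFields-20541** (`Record13SepCoPHInhabited`), `--kind proof --supports stmt-QuantumFields-20541 --as helper`.
[6] = [Balaban1985RegularSpaces] (Prop. 6 p. 99, p. 98); [15] = [Balaban1985Variational] ((152) p. 301).

WHAT THIS FILE PROVES (kernel; theorems only, 0 `def`) — three corollaries BY NAME of the closing theorem `K0Stub2PrimeHolds.prop6MemberB8AtP_holds`
(k0-s2-w1; = T4 `B8Ineq159FlatCubeMemberTransplant.ineq159FlatCubeMemberPrinted_holds` (dag-n05-c) ∘ Fγ10b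
`B8Prop6CubeMemberScalarGammaOfIneq159Printed.gaugedBoundB8_cubeMember_scalar_γ_of_ineq159Printed` (dag-n05-e) ∘ `K0Stub2PrimeJunction.prop6MemberB8AtP_of_perCubeLetterPow`)
with this seat's normal form (`K0Stub2PrimeDatumForm`, p593265) and flux floor (`K0Stub2PrimeFluxFloor`, p593271):
§1 ★★★ `prop6_printClass_minimal_holds` — FOR EVERY `T⁴` FAMILY `F` THERE ARE a big-block size `ρ₀ ≥ 1` and constants `B₁ > 0`, `c₁ > 0` such that for every
   spacing `η > 0`, every PRINT cube datum of `ℤ⁴` at `ρ₀` (`k ≥ 1`; `a ∈ ρ₀ℤ⁴`; `ρ, M ∈ ρ₀ℕ`, `L ≤ ρ ≤ M`, `44 < M`, `L ≤ 4M`; any ambient family), every unitary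
   `U₀ : ℤ⁴-bonds → U(2) ⊂ M₂(ℂ)` with the MINIMAL smallness (`|U₀(∂p) − 1| < α₀L^{−2j}`, `|D*∂U₀| < α₀L^{−2j}(Lʲη)⁻¹` on `□̃` for `j < k`, on `□` for `j = k`)
   and `7·4·L²·M·α₀ ≤ c₁`: (1.135)–(1.138) hold with `7·4·L²·B₁·M·α₀` — [6] Proposition 6 AS PRINTED on print's p. 98 cube class, with NO ambient index,
   NO named fact, NO hypothesis; `B₁ > 0` by the flux floor.
§2 `prop6MemberB8AtP_holds_floor` — every witness of the closed stub has `1 ≤ 2912·L⁵·B₁`; the closed stub's witness in particular.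
§3 `prop6Printed_zdCubP_holds_family` — the N05-facing form: `∃ ρ₀ B₁ c₁, 1 ≤ ρ₀ ∧ 0 < B₁ ∧ 0 < c₁ ∧ ∀ ι (f : ι → ZdIdx 4 F.L), B8.Prop6Printed 4 L B₁ c₁ (zdCubP (MatA 2) F.L ρ₀ ∘ f)`
   (every index map — n05-e's plug shape), and `…_dvd` — WLOG `F.L ∣ ρ₀`.

HONEST FRAMING: corollaries BY NAME of tree theorems (std axioms); what is PROVED is the TREE's sentence `GaugedBoundB8` ∕ `InAk` ∕ `zdCubP` — whether NODE 00's
letters carry the full analytic content of print's (1.135)–(1.138) is what the LOCATED notes on node00-def-cube record (A6); V18's WIDER stub 2 (thin collars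
`ρ = L`) is NOT proved and not claimed; K0⁷ remains OPEN (stubs 1 and 3ᴬ′); the N05 discharge word is the director's ∕ referees'; counts as booked by the chair;
one finite `𝕋⁴` programme at fixed `ε = L^{−K}`; the YM mass gap (Clay) is NOT proved by any of this — R4 closes the conditional finite-`𝕋⁴` rung `BalabanLadder.UV`
only; nothing continuum ∕ ℝ⁴ ∕ OS.  THEOREMS ONLY: no `def`, `instance`, `notation`, `sorry`; standard axioms; default heartbeats.
-/

noncomputable section

open scoped Matrix.Norms.L2Operator

namespace Summit.QuantumFields.YangMills.Theorems.K0Stub2PrimePrintSentence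

open Literature.MathematicalPhysics.QuantumFieldTheory.Balaban1983to89
open Literature.MathematicalPhysics.QuantumFieldTheory.Balaban1983to89.Node00
open Literature.MathematicalPhysics.QuantumFieldTheory.Balaban1983to89.T4Continuum
open B7Prop1Explicit (Site)
open B7Prop2Explicit (unitaryUnits)
open B8LeafModelZd (ZdIdx)
open B8Ineq132 (InAk CondAt)
open B8Eq131Cubes (box tcube)
open Summit.QuantumFields.YangMills.Theorems.K0Stub2PrimeHolds (prop6MemberB8AtP_holds)
open Summit.QuantumFields.YangMills.Theorems.K0Stub2PrimeDatumForm (prop6Printed_zdCubP_iff_minimal prop6Printed_zdCubP_of_minimal)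
open Summit.QuantumFields.YangMills.Theorems.K0Stub2PrimeFluxFloor (pos_of_prop6MemberP one_le_of_prop6MemberP)

variable (F : T4Family)

/-! ## §1  [6] Proposition 6 as printed, index-free, positive constant -/

/-- ★★★ **[6] PROPOSITION 6 ON PRINT'S p. 98 CUBE CLASS, AS PRINTED, FOR EVERY `T⁴` FAMILY — NO HYPOTHESIS**: there are `ρ₀ ≥ 1` (print's big block
`R₁M₁`), `B₁ > 0` and `c₁ > 0` (depending on `L = F.L` only) such that for every spacing `η > 0`, every print cube datum `c` of `ℤ⁴` at `ρ₀` over any ambient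
family, every unitary `U₀` with the level-`j` conditions (1.7)∕(1.9) on `□̃` for `j < k` and the level-`k` conditions on `□`, and `7·4·L²·M·α₀ ≤ c₁`:
«there exists a gauge transformation u on □̃ with U₀^{u⁻¹} = e^{iηA}, Lʲη|A|, (Lʲη)²|∇A|, (Lʲη)³|∂*∂A|, (Lʲη)³|ΔA| ≤ 7dL²B₁Mα₀ on □_j, Q_k(ηA) = (1/i) log Ū₀′ᵏ,
R∂*A = 0» (`GaugedBoundB8`).  = `prop6MemberB8AtP_holds` read through `prop6Printed_zdCubP_iff_minimal`, positivity by `pos_of_prop6MemberP`.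
[cite: Balaban1985RegularSpaces, Prop. 6 (1.135)–(1.138) p.99, p.98 («M is a multiple of R₁M₁ … R₁, M₁ are smallest integers for which all the theorems of the papers [2, 4] are valid»), (1.7)–(1.9) p.77] -/
theorem prop6_printClass_minimal_holds :
    letI : CStarAlgebra (MatA 2) := {};
    ∃ ρ₀ : ℕ, ∃ B₁ c₁ : ℝ, 1 ≤ ρ₀ ∧ 0 < B₁ ∧ 0 < c₁ ∧
      ∀ (η : ℝ), 0 < η → ∀ {K : ℕ} {Ω : ℕ → Set (Site 4)} (c : CubeB8 4 F.L K Ω), c.IsPrint ρ₀ → ∀ (α₀ : ℝ), 0 < α₀ →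
        ∀ (U₀ : Site 4 → Fin 4 → (MatA 2)ˣ), (∀ x κ, U₀ x κ ∈ unitaryUnits (MatA 2)) →
        (∀ j, j < c.k → CondAt F.L η α₀ j (tcube F.L c.a c.M c.ρ c.k) U₀) → CondAt F.L η α₀ c.k (box F.L c.a c.M c.k) U₀ →
        7 * (4 : ℕ) * (F.L : ℝ) ^ 2 * c.M * α₀ ≤ c₁ → GaugedBoundB8 F.L η U₀ c (7 * (4 : ℕ) * (F.L : ℝ) ^ 2 * B₁ * c.M * α₀) := by
  letI : CStarAlgebra (MatA 2) := {}
  obtain ⟨ρ₀, B₁, c₁, hρ₀, hB₁, hc₁, h6⟩ := prop6MemberB8AtP_holds F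
  exact ⟨ρ₀, B₁, c₁, hρ₀, pos_of_prop6MemberP (F := F) (N := 2) (by norm_num) hρ₀ hB₁ hc₁ h6, hc₁,
    (prop6Printed_zdCubP_iff_minimal (𝔸 := MatA 2) ρ₀ B₁ c₁).1 h6⟩

/-! ## §2  The quantitative floor of the closed stub's constant -/

/-- **EVERY WITNESS OF THE CLOSED STUB 2′ HAS `1 ≤ 2912·L⁵·B₁`** — in particular the one `prop6MemberB8AtP_holds` provides (n05-e's `B₁ = 5·4·L·B₀`, `B₀ ≥ 1`).
[cite: Balaban1985RegularSpaces, Prop. 6 p.99 (bookkeeping floor); Balaban1985Variational, (152) p.301] -/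
theorem prop6MemberB8AtP_holds_floor :
    ∃ ρ₀ : ℕ, ∃ B₁ c₁ : ℝ, 1 ≤ ρ₀ ∧ 1 ≤ 2912 * (F.L : ℝ) ^ 5 * B₁ ∧ 0 < c₁ ∧
      (letI : CStarAlgebra (MatA 2) := {}; B8.Prop6Printed 4 (F.L : ℝ) B₁ c₁ (fun i : ZdIdx 4 F.L => zdCubP (MatA 2) F.L ρ₀ i)) := by
  letI : CStarAlgebra (MatA 2) := {}
  obtain ⟨ρ₀, B₁, c₁, hρ₀, hB₁, hc₁, h6⟩ := prop6MemberB8AtP_holds F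
  exact ⟨ρ₀, B₁, c₁, hρ₀, one_le_of_prop6MemberP (F := F) (N := 2) (by norm_num) hρ₀ hB₁ hc₁ h6, hc₁, h6⟩

/-! ## §3  The N05-facing forms: every index map; WLOG `F.L ∣ ρ₀` -/

/-- **PROPOSITION 6 ON PRINT'S CLASS OVER EVERY INDEX MAP** (n05-e's plug shape `∀ ι (f : ι → ZdIdx 4 F.L), B8.Prop6Printed … (zdCubP … ρ₀ ∘ f)`), with `B₁ > 0`.
[cite: Balaban1985RegularSpaces, Prop. 6 p.99, p.98] -/
theorem prop6Printed_zdCubP_holds_family :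
    ∃ ρ₀ : ℕ, ∃ B₁ c₁ : ℝ, 1 ≤ ρ₀ ∧ 0 < B₁ ∧ 0 < c₁ ∧
      ∀ {ι : Type} (f : ι → ZdIdx 4 F.L),
        (letI : CStarAlgebra (MatA 2) := {}; B8.Prop6Printed 4 (F.L : ℝ) B₁ c₁ (fun j => zdCubP (MatA 2) F.L ρ₀ (f j))) := by
  letI : CStarAlgebra (MatA 2) := {}
  obtain ⟨ρ₀, B₁, c₁, hρ₀, hB₁, hc₁, H⟩ := prop6_printClass_minimal_holds F
  exact ⟨ρ₀, B₁, c₁, hρ₀, hB₁, hc₁, fun f => prop6Printed_zdCubP_of_minimal (𝔸 := MatA 2) ρ₀ H f⟩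

/-- **WLOG THE BIG BLOCK IS A MULTIPLE OF `L`**: the closed stub with `F.L ∣ ρ₀` and `B₁ > 0` (coarser blocks are weaker, `prop6Printed_zdCubP_anti`) — the shape
dag-n07-e's bare-block tokens `…_of_one_le` (block `ρ₀·F.L`) instantiate. [cite: Balaban1985RegularSpaces, Prop. 6 p.99, p.98 (bookkeeping)] -/
theorem prop6MemberB8AtP_holds_dvd :
    ∃ ρ₀ : ℕ, ∃ B₁ c₁ : ℝ, 1 ≤ ρ₀ ∧ F.L ∣ ρ₀ ∧ 0 < B₁ ∧ 0 < c₁ ∧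
      (letI : CStarAlgebra (MatA 2) := {}; B8.Prop6Printed 4 (F.L : ℝ) B₁ c₁ (fun i : ZdIdx 4 F.L => zdCubP (MatA 2) F.L ρ₀ i)) := by
  letI : CStarAlgebra (MatA 2) := {}
  have hL : 1 ≤ F.L := by have := F.hL11; omega
  obtain ⟨ρ₀, B₁, c₁, hρ₀, hB₁, hc₁, h6⟩ := prop6MemberB8AtP_holds F
  exact ⟨ρ₀ * F.L, B₁, c₁, le_trans hρ₀ (Nat.le_mul_of_pos_right ρ₀ hL), Dvd.intro_left ρ₀ rfl,
    pos_of_prop6MemberP (F := F) (N := 2) (by norm_num) hρ₀ hB₁ hc₁ h6, hc₁,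
    prop6Printed_zdCubP_anti (fun i : ZdIdx 4 F.L => i) (Dvd.intro F.L rfl) h6⟩

end Summit.QuantumFields.YangMills.Theorems.K0Stub2PrimePrintSentence

end
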